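import Literature.Computability.QuantumComplexity.PauliRotationPropagation
import Mathlib.Analysis.CStarAlgebra.Matrix
import Mathlib.Analysis.Normed.Algebra.MatrixExponential
import Mathlib.Analysis.SpecialFunctions.Exponential
import Mathlib.Analysis.Calculus.Deriv.Mul
import Mathlib.Analysis.Calculus.Deriv.Add
import Mathlib.Analysis.Calculus.Deriv.Comp
import HarnessLib

/-!
# The operator Loschmidt echo: the printed signal, its elementary properties, and its EXACT relation
  to the OTOC for a Pauli-rotation perturbation

Topic `Literature/Computability/QuantumComplexity` (pub-qadeq lane, register row E-44: Barron et al.,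
IBM Research + Algorithmiq + collaborators, *Observable Estimation in the Absence of Classical
Verification*, arXiv:2607.25998v1 (July 2026; unrefereed) — the Quantum Advantage Tracker's
‘observable estimation’ entry; held text `paper:arxiv-2607.25998` p0002 L63–101). Sequel of the
tree's `OutOfTimeOrderCorrelator.lean` (`OTOC.heis U B = U† B U`, the correlators of rows E-05 / E-22)
and `PauliRotationPropagation.lean` (`pauliRot θ G = e^{−iθG/2} = cos(θ/2)·1 − i sin(θ/2)·P_G`).

HONEST FRAMING: instance-level adjudication of specific advantage claims; no claim about BQP vs BPP
or the summit. This file TYPES the scored quantity of E-44 as printed and proves exact finite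
identities about it; it says nothing about the 56-qubit circuits, noise, error mitigation, or the
classical methods compared in that paper.

## Source (verbatim, p0002)

"Given an observable `O`, a unitary `U` on `n` qubits, and a perturbation `V_δ` of strength `δ`, the OLE
signal is `S_δ = (1/2ⁿ) Tr[U†OU · V_δ† · U†OU · V_δ]`. (1) Here, `V_δ` is the product of single-qubit
rotations by an angle `δ` on a subset of qubits. … Experimentally, the initial operator `O` is prepared
through its ensemble representation—the qubits are initialized in random eigenstates of `O`. … The OLE
is the operator analog of the more familiar state Loschmidt echo … At small `δ`, it has a linear
dependence on the out-of-time-order correlator (OTOC) `C` [16] between `O` and the generator of `V_δ`: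
`S_δ ≈ 1 − (δ²/2) C`."

## Contents (all proved; no named facts)

General part, `Matrix m m ℂ` for any finite index type `m` (dimension `d = |m|`):
* **`signal U O V = d⁻¹ · Tr[U†OU · V† · U†OU · V]`** — eq. (1) (`signal_eq`).
* `signal_one_right`: no perturbation (`V = 1`) and an involutive observable (`O² = 1`, e.g. a Pauli)
  give `S = 1` for unitary `U`.
* `star_signal`: for Hermitian `O` the signal is REAL (for every `V`), by cyclicity of the trace.
* `norm_signal_le_one`: for unitary `U`, `V` and a Hermitian involution `O`, `|S| ≤ 1` (the trace of
  the unitary `U†OU V† U†OU V` has modulus at most `d`).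
* **`trace_mul_sandwich`**: if `V† A V = a·A + b·PAP + e·PA − e·AP` — the form a rotation
  `V = c·1 − i s·P` about an involution `P` produces (`conjTranspose_pauliRot_mul_mul_pauliRot`) —
  then `Tr[A · V†AV] = a·Tr(A²) + b·Tr(A P A P)`: the cross terms `Tr(A·PA) − Tr(A·AP)` cancel.

Pauli part, registers `ι → Bool`, perturbation = ONE Pauli-string rotation `V = pauliRot θ G = e^{−iθG/2}`
(the printed `V_δ` restricted to a perturbation generated by a single Pauli string `P_G`; the general
Hermitian generator is the v2 section below):
* **`signal_pauliRot`** (exact, every `θ`): for unitary `U` and an observable with `O² = 1`,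
  `S = cos²(θ/2) + sin²(θ/2) · F`, where `F = d⁻¹ Tr[A P_G A P_G]`, `A = U†OU`, is the
  infinite-temperature OTOC of the tree (`OTOC.corr 1 (d⁻¹•1) U O P_G`, `signal_pauliRot_eq_corr`);
* **`signal_pauliRot_eq_one_sub`**: equivalently `S = 1 − sin²(θ/2)·(1 − F)`, and with the normalised
  squared commutator `C = d⁻¹ Tr([A,P_G]†[A,P_G]) = 2(1 − F)` (`sqComm_eq`, for Hermitian `O`):
  **`S = 1 − ½ sin²(θ/2) · C`** (`signal_pauliRot_eq_one_sub_half_sqComm`). For `V_δ = e^{−iδ P_G}`,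
  i.e. `θ = 2δ`, this reads `S_δ = 1 − ½ sin²(δ) C`, whose small-`δ` form is the printed
  `S_δ ≈ 1 − (δ²/2) C`; at `θ = π` (`V = −iP_G`) the signal IS the OTOC, `S = F` (`signal_pauliRot_pi`).

General Hermitian generator (v2), `V_δ = e^{−iδG}` = `genPert G δ` (Mathlib's matrix exponential; the
printed product of commuting single-qubit rotations is `genPert` of the sum of their generators,
`genPert_add_of_commute`): `conjTranspose_genPert` (`V_δ† = e^{iδG}`), `genSignal` (`S(δ)`),
`genSignal_zero` (`S(0) = 1`), `genSignalDeriv` with **`hasDerivAt_genSignal`** (the derivative for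
every `δ`), **`genSignalDeriv_zero`** (`S'(0) = 0`), **`hasDerivAt_genSignalDeriv_zero`** (`S''(0) =
d⁻¹Tr(−AG²A + 2AGAG − A²G²)`) and **`genSignal_secondOrder`**: `S(0) = 1`, `S'(0) = 0`,
`S''(0) = −C` with `C = d⁻¹ Tr([A,G]†[A,G])` — the printed `S_δ ≈ 1 − (δ²/2)C` as the exact
second-order Taylor data, for ANY Hermitian generator.

## What is NOT formalised

The ensemble-of-eigenstates measurement protocol and its variance, higher-order correlators (App. A of
the source), the remainder term beyond second order, anything about noise, PEC/ZNE bounds or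
tensor-network / Pauli-propagation estimates.
-/

noncomputable section

open Matrix

namespace Literature.Computability.QuantumComplexity

namespace OLE

open OTOC PauliPropagation

section General

variable {m : Type*} [Fintype m] [DecidableEq m]

/-- **The operator Loschmidt echo signal** `S = d⁻¹ Tr[U†OU · V† · U†OU · V]` of an observable `O`,
an evolution `U` and a perturbation `V` (`d = |m|`, `2ⁿ` for `n` qubits).
[cite: BarronEtAl2026, eq. (1) (`S_δ = 2^{−n} Tr[U†OU · V_δ† · U†OU · V_δ]`)] -/
def signal (U O V : Matrix m m ℂ) : ℂ :=
  ((Fintype.card m : ℂ))⁻¹ * (heis U O * Vᴴ * heis U O * V).trace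

omit [DecidableEq m] in
/-- Unfolding of `signal`. [cite: BarronEtAl2026, eq. (1)] -/
theorem signal_eq (U O V : Matrix m m ℂ) :
    signal U O V = ((Fintype.card m : ℂ))⁻¹ * (heis U O * Vᴴ * heis U O * V).trace := rfl

/-- **No perturbation**: for unitary `U`, an involutive observable (`O² = 1`) and `V = 1`, `S = 1`.
[cite: BarronEtAl2026, eq. (1) and text (`S_δ ≈ 1 − (δ²/2)C`: the signal starts at `1`)] -/
theorem signal_one_right [Nonempty m] {U O : Matrix m m ℂ} (hU : U * Uᴴ = 1) (hO : O * O = 1) :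
    signal U O 1 = 1 := by
  rw [signal_eq, conjTranspose_one, Matrix.mul_one, Matrix.mul_one, heis_mul_heis hU, hO, heis,
    Matrix.mul_one, ← Matrix.star_eq_conjTranspose,
    (Matrix.mem_unitaryGroup_iff'.mp (Matrix.mem_unitaryGroup_iff.mpr
      (by rwa [Matrix.star_eq_conjTranspose]))), trace_one]
  exact inv_mul_cancel₀ (Nat.cast_ne_zero.mpr Fintype.card_ne_zero)

omit [DecidableEq m] in
/-- **The signal is real** for a Hermitian observable (any `U`, any `V`):
`conj S = d⁻¹ Tr[(A V† A V)†] = d⁻¹ Tr[V† A V A] = S` by cyclicity. [cite: BarronEtAl2026, eq. (1)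
(the OLE signal is plotted as a real number, Fig. 1)] -/
theorem star_signal {U O : Matrix m m ℂ} (hO : Oᴴ = O) (V : Matrix m m ℂ) :
    star (signal U O V) = signal U O V := by
  have hA : (heis U O)ᴴ = heis U O := by rw [conjTranspose_heis, hO]
  have htr : ((heis U O * Vᴴ * heis U O * V)ᴴ).trace = (heis U O * Vᴴ * heis U O * V).trace := by
    rw [conjTranspose_mul, conjTranspose_mul, conjTranspose_mul, conjTranspose_conjTranspose, hA]
    -- `Vᴴ (A (V A))`-type reassociation and one cyclic move
    calc (Vᴴ * (heis U O * (V * heis U O))).trace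
        = ((Vᴴ * heis U O * V) * heis U O).trace := by simp only [Matrix.mul_assoc]
      _ = (heis U O * (Vᴴ * heis U O * V)).trace := Matrix.trace_mul_comm _ _
      _ = (heis U O * Vᴴ * heis U O * V).trace := by simp only [Matrix.mul_assoc]
  rw [signal_eq, star_mul', star_inv₀, star_natCast, ← Matrix.trace_conjTranspose, htr]

/-- The trace of a unitary has modulus at most the dimension. [folklore] -/
private theorem norm_trace_le_card_of_unitary {W : Matrix m m ℂ} (hW : W ∈ Matrix.unitaryGroup m ℂ) :
    ‖W.trace‖ ≤ Fintype.card m := by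
  rw [Matrix.trace]
  calc ‖∑ i, W.diag i‖ ≤ ∑ i, ‖W.diag i‖ := norm_sum_le _ _
    _ ≤ ∑ _i : m, (1 : ℝ) := Finset.sum_le_sum fun i _ => entry_norm_bound_of_unitary hW i i
    _ = Fintype.card m := by simp

/-- **`|S| ≤ 1`** for unitary `U`, `V` and a Hermitian involutive observable (`O† = O`, `O² = 1`):
the operator `U†OU · V† · U†OU · V` is unitary. [cite: BarronEtAl2026, eq. (1) and Fig. 1 (the OLE
signal lies in `[−1, 1]`)] -/
theorem norm_signal_le_one {U O V : Matrix m m ℂ} (hU : U ∈ Matrix.unitaryGroup m ℂ)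
    (hO : Oᴴ = O) (hO2 : O * O = 1) (hV : V ∈ Matrix.unitaryGroup m ℂ) :
    ‖signal U O V‖ ≤ 1 := by
  have hOu : O ∈ Matrix.unitaryGroup m ℂ := by
    rw [Matrix.mem_unitaryGroup_iff, Matrix.star_eq_conjTranspose, hO, hO2]
  have hA : heis U O ∈ Matrix.unitaryGroup m ℂ := by
    have hUs : star U ∈ Matrix.unitaryGroup m ℂ := Unitary.star_mem hU
    simpa [heis, Matrix.star_eq_conjTranspose] using
      Submonoid.mul_mem _ (Submonoid.mul_mem _ hUs hOu) hU
  have hW : heis U O * Vᴴ * heis U O * V ∈ Matrix.unitaryGroup m ℂ := by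
    have hVs : Vᴴ ∈ Matrix.unitaryGroup m ℂ := by
      rw [← Matrix.star_eq_conjTranspose]; exact Unitary.star_mem hV
    exact Submonoid.mul_mem _ (Submonoid.mul_mem _ (Submonoid.mul_mem _ hA hVs) hA) hV
  by_cases hm : Nonempty m
  · have hd : (0 : ℝ) < Fintype.card m := by exact_mod_cast Fintype.card_pos
    rw [signal_eq, norm_mul, norm_inv, Complex.norm_natCast, inv_mul_le_iff₀ hd, mul_one]
    exact norm_trace_le_card_of_unitary hW
  · haveI : IsEmpty m := not_nonempty_iff.mp hm
    rw [signal_eq, Fintype.card_eq_zero, Nat.cast_zero, _root_.inv_zero, zero_mul, norm_zero]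
    exact zero_le_one

omit [DecidableEq m] in
/-- **The cross terms cancel.** If the perturbed operator has the form
`V† A V = a·A + b·P A P + e·P A + f·A P` (as for a rotation `V = c·1 − i s·P`, see below), then
`Tr[A · V†AV] = a·Tr(A²) + b·Tr(A P A P) + (e + f)·Tr(A P A)`, and `Tr(A·PA) = Tr(A·AP)`; for the
rotation `e = −f`, so only the `A²` and `APAP` (OTOC) terms survive. [cite: BarronEtAl2026, p. 2
("At small δ, it has a linear dependence on the out-of-time-order correlator (OTOC) C between O and the
generator of V_δ")] -/
theorem trace_mul_sandwich (A P : Matrix m m ℂ) (a b e : ℂ) :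
    (A * (a • A + b • (P * A * P) + e • (P * A) + (-e) • (A * P))).trace =
      a * (A * A).trace + b * (A * P * A * P).trace := by
  have hcyc : (A * (P * A)).trace = (A * (A * P)).trace := by
    rw [← Matrix.mul_assoc, Matrix.trace_mul_comm (A * P) A]
  simp only [Matrix.mul_add, Matrix.mul_smul, trace_add, trace_smul, smul_eq_mul, hcyc]
  simp only [Matrix.mul_assoc]
  ring

end General

/-! ### One Pauli-string rotation: `S = cos²(θ/2) + sin²(θ/2)·OTOC`, exactly -/

section PauliRotation

variable {ι : Type*} [Fintype ι] [DecidableEq ι]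

/-- `R_G(θ)† A R_G(θ) = cos²(θ/2) A + sin²(θ/2) P A P + i cos(θ/2)sin(θ/2) (P A − A P)` for
`R_G(θ) = cos(θ/2)·1 − i sin(θ/2)·P`, `P = P_G`. [cite: BarronEtAl2026, eq. (1) (the perturbation
`V_δ`, a rotation)] -/
theorem conjTranspose_pauliRot_mul_mul_pauliRot (θ : ℝ) (G : ι → Pauli)
    (A : Matrix (ι → Bool) (ι → Bool) ℂ) :
    (pauliRot θ G)ᴴ * A * pauliRot θ G =
      ((Real.cos (θ / 2) : ℂ) ^ 2) • A + ((Real.sin (θ / 2) : ℂ) ^ 2) • (pauliString G * A * pauliString G) +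
        (Complex.I * Real.cos (θ / 2) * Real.sin (θ / 2)) • (pauliString G * A) +
        (-(Complex.I * Real.cos (θ / 2) * Real.sin (θ / 2))) • (A * pauliString G) := by
  rw [conjTranspose_pauliRot, pauliRot_eq_add, pauliRot_eq_add, neg_div, Real.cos_neg, Real.sin_neg]
  simp only [Complex.ofReal_neg, add_mul, mul_add, Matrix.smul_mul, Matrix.mul_smul, Matrix.one_mul,
    Matrix.mul_one, smul_smul]
  have hI : Complex.I * Complex.I = -1 := Complex.I_mul_I
  -- the `PAP` coefficient: `(−i s)(−i·(−s)) = −i² s² = s²`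
  have e1 : -(Complex.I * (Real.sin (θ / 2) : ℂ)) * -(Complex.I * -(Real.sin (θ / 2) : ℂ)) =
      ((Real.sin (θ / 2) : ℂ)) ^ 2 := by
    linear_combination (-((Real.sin (θ / 2) : ℂ)) ^ 2) * hI
  rw [e1]
  module

/-- **The OLE signal of a Pauli-string rotation, exactly**: for unitary `U`, an involutive observable
`O² = 1` and the perturbation `V = R_G(θ) = e^{−iθ P_G/2}`,
`S = cos²(θ/2) + sin²(θ/2) · F` with `F = d⁻¹ Tr[A P_G A P_G]`, `A = U†OU` (the
infinite-temperature OTOC between the evolved observable and the generator). [cite: BarronEtAl2026,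
eq. (1) and p. 2 ("linear dependence on the out-of-time-order correlator … between O and the generator
of V_δ")] -/
theorem signal_pauliRot {U O : Matrix (ι → Bool) (ι → Bool) ℂ} (hU : U * Uᴴ = 1) (hO : O * O = 1)
    (θ : ℝ) (G : ι → Pauli) :
    signal U O (pauliRot θ G) =
      (Real.cos (θ / 2) : ℂ) ^ 2 + (Real.sin (θ / 2) : ℂ) ^ 2 *
        (((Fintype.card (ι → Bool) : ℂ))⁻¹ *
          (heis U O * pauliString G * heis U O * pauliString G).trace) := by
  have hA2 : heis U O * heis U O = 1 := by
    rw [heis_mul_heis hU, hO, heis, Matrix.mul_one, ← Matrix.star_eq_conjTranspose,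
      (Matrix.mem_unitaryGroup_iff'.mp (Matrix.mem_unitaryGroup_iff.mpr
        (by rwa [Matrix.star_eq_conjTranspose])))]
  have hd : ((Fintype.card (ι → Bool) : ℂ)) ≠ 0 := Nat.cast_ne_zero.mpr Fintype.card_ne_zero
  rw [signal_eq, Matrix.mul_assoc (heis U O) (pauliRot θ G)ᴴ, Matrix.mul_assoc (heis U O),
    conjTranspose_pauliRot_mul_mul_pauliRot, trace_mul_sandwich, hA2, trace_one]
  field_simp

/-- … in the tree's OTOC vocabulary: `S = cos²(θ/2) + sin²(θ/2) · C⁽²⁾` with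
`C⁽²⁾ = OTOC.corr 1 ρ_∞ U O P_G` the correlator of `OutOfTimeOrderCorrelator.lean` in the
infinite-temperature state `ρ_∞ = d⁻¹·1` (for Hermitian `O`). [cite: BarronEtAl2026, p. 2]
[cite: MiEtAl2021, eq. (1) (the OTOC `⟨Ô†(t) M̂† Ô(t) M̂⟩`)] -/
theorem signal_pauliRot_eq_corr {U O : Matrix (ι → Bool) (ι → Bool) ℂ} (hU : U * Uᴴ = 1)
    (hO : Oᴴ = O) (hO2 : O * O = 1) (θ : ℝ) (G : ι → Pauli) :
    signal U O (pauliRot θ G) =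
      (Real.cos (θ / 2) : ℂ) ^ 2 + (Real.sin (θ / 2) : ℂ) ^ 2 *
        corr 1 (((Fintype.card (ι → Bool) : ℂ))⁻¹ • (1 : Matrix (ι → Bool) (ι → Bool) ℂ)) U O
          (pauliString G) := by
  rw [signal_pauliRot hU hO2, corr_one, conjTranspose_heis, hO, Matrix.smul_mul, Matrix.one_mul,
    trace_smul, smul_eq_mul]

/-- **`S = 1 − sin²(θ/2)·(1 − F)`**: the deviation of the OLE signal from `1` is `sin²(θ/2)` times
the deviation of the OTOC from its commuting value `1`. [cite: BarronEtAl2026, p. 2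
(`S_δ ≈ 1 − (δ²/2) C`)] -/
theorem signal_pauliRot_eq_one_sub {U O : Matrix (ι → Bool) (ι → Bool) ℂ} (hU : U * Uᴴ = 1)
    (hO : O * O = 1) (θ : ℝ) (G : ι → Pauli) :
    signal U O (pauliRot θ G) =
      1 - (Real.sin (θ / 2) : ℂ) ^ 2 *
        (1 - ((Fintype.card (ι → Bool) : ℂ))⁻¹ *
          (heis U O * pauliString G * heis U O * pauliString G).trace) := by
  rw [signal_pauliRot hU hO]
  have h1 : (Real.cos (θ / 2) : ℂ) ^ 2 + (Real.sin (θ / 2) : ℂ) ^ 2 = 1 := by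
    rw [← Complex.ofReal_pow, ← Complex.ofReal_pow, ← Complex.ofReal_add, Real.cos_sq_add_sin_sq,
      Complex.ofReal_one]
  linear_combination h1

/-- The normalised squared commutator `C = d⁻¹ Tr([A,P]†[A,P])` of the evolved observable `A = U†OU`
with the generator equals `2(1 − F)`, `F = d⁻¹Tr(APAP)`, for Hermitian involutive `O` and unitary `U`
(the tree's `OTOC.commutator_conjTranspose_mul`, traced). [cite: MiEtAl2021, p. 2
(`C(t) = 1 − ½⟨|[Ô(t), M̂]|²⟩`)] [cite: BarronEtAl2026, p. 2] -/
theorem sqComm_eq {U O : Matrix (ι → Bool) (ι → Bool) ℂ} (hU : U * Uᴴ = 1) (hO : Oᴴ = O)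
    (hO2 : O * O = 1) (G : ι → Pauli) :
    ((Fintype.card (ι → Bool) : ℂ))⁻¹ *
        ((heis U O * pauliString G - pauliString G * heis U O)ᴴ *
          (heis U O * pauliString G - pauliString G * heis U O)).trace =
      2 * (1 - ((Fintype.card (ι → Bool) : ℂ))⁻¹ *
        (heis U O * pauliString G * heis U O * pauliString G).trace) := by
  have hA : (heis U O)ᴴ = heis U O := by rw [conjTranspose_heis, hO]
  have hA2 : heis U O * heis U O = 1 := by
    rw [heis_mul_heis hU, hO2, heis, Matrix.mul_one, ← Matrix.star_eq_conjTranspose,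
      (Matrix.mem_unitaryGroup_iff'.mp (Matrix.mem_unitaryGroup_iff.mpr
        (by rwa [Matrix.star_eq_conjTranspose])))]
  have hAu : (heis U O)ᴴ * heis U O = 1 := by rw [hA, hA2]
  have hPu : (pauliString G)ᴴ * pauliString G = 1 := by
    rw [conjTranspose_pauliString, pauliString_mul_self]
  have hd : ((Fintype.card (ι → Bool) : ℂ)) ≠ 0 := Nat.cast_ne_zero.mpr Fintype.card_ne_zero
  rw [commutator_conjTranspose_mul hAu hPu, hA, conjTranspose_pauliString]
  -- `Tr(2 − APAP − (APAP)ᴴ) = 2d − 2 Tr(APAP)` since `Tr((APAP)ᴴ) = conj Tr(APAP) = Tr(PAPA) = Tr(APAP)`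
  have hcyc : ((heis U O * pauliString G * heis U O * pauliString G)ᴴ).trace =
      (heis U O * pauliString G * heis U O * pauliString G).trace := by
    rw [conjTranspose_mul, conjTranspose_mul, conjTranspose_mul, hA, conjTranspose_pauliString]
    calc (pauliString G * (heis U O * (pauliString G * heis U O))).trace
        = ((pauliString G * heis U O * pauliString G) * heis U O).trace := by
          simp only [Matrix.mul_assoc]
      _ = (heis U O * (pauliString G * heis U O * pauliString G)).trace := Matrix.trace_mul_comm _ _
      _ = (heis U O * pauliString G * heis U O * pauliString G).trace := by
          simp only [Matrix.mul_assoc]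
  rw [trace_sub, trace_sub, hcyc, show (2 : Matrix (ι → Bool) (ι → Bool) ℂ) = (2 : ℂ) • 1 by
    rw [← one_add_one_eq_two, ← one_add_one_eq_two, add_smul, one_smul], trace_smul, trace_one,
    smul_eq_mul]
  field_simp
  ring

/-- **`S = 1 − ½ sin²(θ/2) · C`** with `C` the normalised squared commutator of `U†OU` with the
generator `P_G`: the exact OLE–OTOC relation for one Pauli-string rotation `V = e^{−iθP_G/2}`. For
`V_δ = e^{−iδP_G}` (`θ = 2δ`) it reads `S_δ = 1 − ½ sin²δ · C`, whose small-`δ` expansion is the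
printed `S_δ ≈ 1 − (δ²/2) C`. [cite: BarronEtAl2026, p. 2 ("At small δ, it has a linear dependence
on the out-of-time-order correlator (OTOC) C … : S_δ ≈ 1 − δ²/2 C")] -/
theorem signal_pauliRot_eq_one_sub_half_sqComm {U O : Matrix (ι → Bool) (ι → Bool) ℂ}
    (hU : U * Uᴴ = 1) (hO : Oᴴ = O) (hO2 : O * O = 1) (θ : ℝ) (G : ι → Pauli) :
    signal U O (pauliRot θ G) =
      1 - (Real.sin (θ / 2) : ℂ) ^ 2 / 2 *
        (((Fintype.card (ι → Bool) : ℂ))⁻¹ *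
          ((heis U O * pauliString G - pauliString G * heis U O)ᴴ *
            (heis U O * pauliString G - pauliString G * heis U O)).trace) := by
  rw [sqComm_eq hU hO hO2, signal_pauliRot_eq_one_sub hU hO2]
  ring

/-- At `θ = π` (`V = −i P_G`) the OLE signal IS the OTOC: `S = F = d⁻¹Tr(A P A P)`.
[cite: BarronEtAl2026, eq. (1)] [cite: MiEtAl2021, eq. (1)] -/
theorem signal_pauliRot_pi {U O : Matrix (ι → Bool) (ι → Bool) ℂ} (hU : U * Uᴴ = 1) (hO : O * O = 1)
    (G : ι → Pauli) :
    signal U O (pauliRot Real.pi G) =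
      ((Fintype.card (ι → Bool) : ℂ))⁻¹ *
        (heis U O * pauliString G * heis U O * pauliString G).trace := by
  rw [signal_pauliRot hU hO, Real.cos_pi_div_two, Real.sin_pi_div_two]
  push_cast
  ring

/-- At `θ = 0` (no perturbation) `S = 1` again, consistently with `signal_one_right`.
[cite: BarronEtAl2026, eq. (1)] -/
theorem signal_pauliRot_zero {U O : Matrix (ι → Bool) (ι → Bool) ℂ} (hU : U * Uᴴ = 1)
    (hO : O * O = 1) (G : ι → Pauli) : signal U O (pauliRot 0 G) = 1 := by
  rw [signal_pauliRot hU hO, zero_div, Real.cos_zero, Real.sin_zero]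
  push_cast
  ring

end PauliRotation

/-! ### A general Hermitian generator `V_δ = e^{−iδG}`: the printed small-`δ` law
`S_δ ≈ 1 − (δ²/2)·C` as the exact Taylor data `S(0) = 1`, `S'(0) = 0`, `S''(0) = −C`

The printed perturbation is a product of commuting single-qubit rotations, i.e. `e^{−iδG}` for the
(Hermitian) sum `G` of their generators.  Here `S(δ) = signal U O e^{−iδG}` is differentiated twice
at `δ = 0` with Mathlib's calculus in the `ℓ∞`-operator normed algebra structure on matrices
(`Matrix.linftyOpNormedRing`, activated locally; the statements do not depend on the norm). -/

section Generator

variable {m : Type*} [Fintype m] [DecidableEq m]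

-- Mathlib registers no global norm on `Matrix`; as in `Mathlib.Analysis.Normed.Algebra.MatrixExponential`
-- we activate the `ℓ∞`-operator normed-algebra structure LOCALLY (this section only) to be able to
-- speak of `HasDerivAt` for matrix-valued maps.  Every statement below is norm-independent (exact
-- identities and derivatives in the product topology), so nothing leaks to importers.
attribute [local instance] Matrix.linftyOpNormedAddCommGroup Matrix.linftyOpNormedSpace
  Matrix.linftyOpNormedRing Matrix.linftyOpNormedAlgebra

/-- Matrices are finite-dimensional, hence complete (for the exponential-derivative lemmas). -/
private local instance : CompleteSpace (Matrix m m ℂ) := FiniteDimensional.complete ℝ (Matrix m m ℂ)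

/-- **The perturbation generated by `G` at strength `δ`**: `V_δ = e^{−iδG}` (Mathlib's matrix
exponential `NormedSpace.exp`).  The printed `V_δ` — a product of commuting single-qubit rotations by
`δ` on a subset `K` of qubits — is `genPert G δ` for the Hermitian generator `G = Σ_{k∈K} g_k`
(`genPert_add_of_commute`). [cite: BarronEtAl2026, p. 2 (eq. (1) and “V_δ is the product of single-qubit rotations by an angle δ on a subset of qubits … S_δ ≈ 1 − (δ²/2) C”)] -/
def genPert (G : Matrix m m ℂ) (δ : ℝ) : Matrix m m ℂ :=
  NormedSpace.exp (δ • (-(Complex.I • G)))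

/-- Unfolding of `genPert`. [cite: BarronEtAl2026, p. 2 (eq. (1) and “V_δ is the product of single-qubit rotations by an angle δ on a subset of qubits … S_δ ≈ 1 − (δ²/2) C”)] -/
theorem genPert_eq (G : Matrix m m ℂ) (δ : ℝ) :
    genPert G δ = NormedSpace.exp (δ • (-(Complex.I • G))) := rfl

/-- `V_0 = 1` (no perturbation). [cite: BarronEtAl2026, p. 2 (eq. (1) and “V_δ is the product of single-qubit rotations by an angle δ on a subset of qubits … S_δ ≈ 1 − (δ²/2) C”)] -/
theorem genPert_zero (G : Matrix m m ℂ) : genPert G 0 = 1 := by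
  rw [genPert_eq, zero_smul, NormedSpace.exp_zero]

/-- For a Hermitian generator, `V_δ† = e^{+iδG}` (`Matrix.exp_conjTranspose`). [cite: BarronEtAl2026, p. 2 (eq. (1) and “V_δ is the product of single-qubit rotations by an angle δ on a subset of qubits … S_δ ≈ 1 − (δ²/2) C”)] -/
theorem conjTranspose_genPert {G : Matrix m m ℂ} (hG : Gᴴ = G) (δ : ℝ) :
    (genPert G δ)ᴴ = NormedSpace.exp (δ • (Complex.I • G)) := by
  rw [genPert_eq, ← Matrix.exp_conjTranspose, conjTranspose_smul, conjTranspose_neg,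
    conjTranspose_smul, hG]
  congr 1
  rw [star_trivial, Complex.star_def, Complex.conj_I, neg_smul, neg_neg]

/-- **The OLE signal along the family `V_δ = e^{−iδG}`**: `S(δ) = signal U O V_δ` (eq. (1) with the
printed perturbation). [cite: BarronEtAl2026, p. 2 (eq. (1) and “V_δ is the product of single-qubit rotations by an angle δ on a subset of qubits … S_δ ≈ 1 − (δ²/2) C”)] -/
def genSignal (U O G : Matrix m m ℂ) (δ : ℝ) : ℂ := signal U O (genPert G δ)

/-- `S(δ) = d⁻¹ Tr[A e^{iδG} A e^{−iδG}]`, `A = U†OU`, for Hermitian `G`. [cite: BarronEtAl2026, p. 2 (eq. (1) and “V_δ is the product of single-qubit rotations by an angle δ on a subset of qubits … S_δ ≈ 1 − (δ²/2) C”)] -/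
theorem genSignal_eq {U O G : Matrix m m ℂ} (hG : Gᴴ = G) (δ : ℝ) :
    genSignal U O G δ = ((Fintype.card m : ℂ))⁻¹ *
      (heis U O * NormedSpace.exp (δ • (Complex.I • G)) * heis U O *
        NormedSpace.exp (δ • (-(Complex.I • G)))).trace := by
  rw [genSignal, signal_eq, conjTranspose_genPert hG, genPert_eq]

/-- `S(0) = 1` for unitary `U` and an involutive observable (`O² = 1`). [cite: BarronEtAl2026, p. 2 (eq. (1) and “V_δ is the product of single-qubit rotations by an angle δ on a subset of qubits … S_δ ≈ 1 − (δ²/2) C”)] -/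
theorem genSignal_zero [Nonempty m] {U O : Matrix m m ℂ} (hU : U * Uᴴ = 1) (hO : O * O = 1)
    (G : Matrix m m ℂ) : genSignal U O G 0 = 1 := by
  rw [genSignal, genPert_zero, signal_one_right hU hO]

/-- The first derivative of `S` along the family, in closed form:
`S'(δ) = d⁻¹ Tr[A (iG e^{iδG}) A e^{−iδG} + A e^{iδG} A (−iG e^{−iδG})]`. [cite: BarronEtAl2026, p. 2 (eq. (1) and “V_δ is the product of single-qubit rotations by an angle δ on a subset of qubits … S_δ ≈ 1 − (δ²/2) C”)] -/
def genSignalDeriv (U O G : Matrix m m ℂ) (δ : ℝ) : ℂ :=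
  ((Fintype.card m : ℂ))⁻¹ *
    (heis U O * ((Complex.I • G) * NormedSpace.exp (δ • (Complex.I • G))) * heis U O *
        NormedSpace.exp (δ • (-(Complex.I • G))) +
      heis U O * NormedSpace.exp (δ • (Complex.I • G)) * heis U O *
        ((-(Complex.I • G)) * NormedSpace.exp (δ • (-(Complex.I • G))))).trace

/-- The trace as a continuous `ℝ`-linear map (finite dimension). [folklore] -/
private def traceCLM : Matrix m m ℂ →L[ℝ] ℂ :=
  LinearMap.toContinuousLinearMap ((Matrix.traceLinearMap m ℂ ℂ).restrictScalars ℝ)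

omit [DecidableEq m] in
/-- Differentiating under the trace. [folklore] -/
private theorem hasDerivAt_trace {f : ℝ → Matrix m m ℂ} {f' : Matrix m m ℂ} {t : ℝ}
    (hf : HasDerivAt f f' t) : HasDerivAt (fun u => (f u).trace) f'.trace t :=
  (traceCLM (m := m)).hasFDerivAt.comp_hasDerivAt t hf

/-- `S` is differentiable everywhere, with derivative `genSignalDeriv` (product rule and
`d/dδ e^{δX} = X e^{δX}`, Mathlib `hasDerivAt_exp_smul_const'`, in the `ℓ∞`-operator normed algebra
structure on matrices). [cite: BarronEtAl2026, p. 2 (eq. (1) and “V_δ is the product of single-qubit rotations by an angle δ on a subset of qubits … S_δ ≈ 1 − (δ²/2) C”)] -/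
theorem hasDerivAt_genSignal {U O G : Matrix m m ℂ} (hG : Gᴴ = G) (δ : ℝ) :
    HasDerivAt (genSignal U O G) (genSignalDeriv U O G δ) δ := by
  set A := heis U O with hA
  set X := Complex.I • G with hX
  have h1 : HasDerivAt (fun u : ℝ => A * NormedSpace.exp (u • X) * A)
      (A * (X * NormedSpace.exp (δ • X)) * A) δ :=
    ((hasDerivAt_exp_smul_const' X δ).const_mul A).mul_const A
  have h2 := h1.mul (hasDerivAt_exp_smul_const' (-X) δ)
  have h3 := (hasDerivAt_trace h2).const_mul (((Fintype.card m : ℂ))⁻¹)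
  have hfun : genSignal U O G = fun y : ℝ => ((Fintype.card m : ℂ))⁻¹ *
      (((fun u : ℝ => A * NormedSpace.exp (u • X) * A) * fun u : ℝ => NormedSpace.exp (u • -X)) y).trace := by
    funext u
    rw [genSignal_eq hG, Pi.mul_apply, hA, hX]
  rw [hfun]
  exact h3

/-- **`S'(0) = 0`**: at `δ = 0` the derivative is `d⁻¹ (i·Tr(AGA) − i·Tr(AAG)) = 0` by cyclicity of
the trace (no hypothesis on `U`, `O`, `G`). [cite: BarronEtAl2026, p. 2 (eq. (1) and “V_δ is the product of single-qubit rotations by an angle δ on a subset of qubits … S_δ ≈ 1 − (δ²/2) C”)] -/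
theorem genSignalDeriv_zero (U O G : Matrix m m ℂ) : genSignalDeriv U O G 0 = 0 := by
  rw [genSignalDeriv, zero_smul, zero_smul, NormedSpace.exp_zero]
  simp only [Matrix.mul_one, Matrix.mul_neg, trace_add, trace_neg]
  -- `Tr(A·X·A) = Tr(A·A·X)` by one cyclic move
  have hcyc : (heis U O * (Complex.I • G) * heis U O).trace =
      (heis U O * heis U O * (Complex.I • G)).trace := by
    rw [Matrix.trace_mul_comm (heis U O * (Complex.I • G)) (heis U O), ← Matrix.mul_assoc]
  rw [hcyc, add_neg_cancel, mul_zero]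

/-- **The second derivative at `0`**: `S''(0) = d⁻¹ Tr(−AG²A + 2·AGAG − A²G²)` (product rule once
more; `(iG)² = −G²`, `A(iG)A(−iG) = AGAG`). [cite: BarronEtAl2026, p. 2 (eq. (1) and “V_δ is the product of single-qubit rotations by an angle δ on a subset of qubits … S_δ ≈ 1 − (δ²/2) C”)] -/
theorem hasDerivAt_genSignalDeriv_zero (U O G : Matrix m m ℂ) :
    HasDerivAt (genSignalDeriv U O G)
      (((Fintype.card m : ℂ))⁻¹ *
        (-(heis U O * (G * G) * heis U O) + heis U O * G * heis U O * G + heis U O * G * heis U O * G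
          - heis U O * heis U O * (G * G)).trace) 0 := by
  set A := heis U O with hA
  set X := Complex.I • G with hX
  -- term 1: u ↦ A (X e^{uX}) A · e^{u(−X)}
  have e1 : HasDerivAt (fun u : ℝ => X * NormedSpace.exp (u • X)) (X * (X * NormedSpace.exp ((0:ℝ) • X))) 0 :=
    (hasDerivAt_exp_smul_const' X 0).const_mul X
  have t1 : HasDerivAt (fun u : ℝ => A * (X * NormedSpace.exp (u • X)) * A * NormedSpace.exp (u • -X))
      (A * (X * (X * NormedSpace.exp ((0:ℝ) • X))) * A * NormedSpace.exp ((0:ℝ) • -X) +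
        A * (X * NormedSpace.exp ((0:ℝ) • X)) * A * (-X * NormedSpace.exp ((0:ℝ) • -X))) 0 :=
    ((e1.const_mul A).mul_const A).mul (hasDerivAt_exp_smul_const' (-X) 0)
  -- term 2: u ↦ A e^{uX} A · (−X e^{u(−X)})
  have e2 : HasDerivAt (fun u : ℝ => -X * NormedSpace.exp (u • -X))
      (-X * (-X * NormedSpace.exp ((0:ℝ) • -X))) 0 :=
    (hasDerivAt_exp_smul_const' (-X) 0).const_mul (-X)
  have t2 : HasDerivAt (fun u : ℝ => A * NormedSpace.exp (u • X) * A * (-X * NormedSpace.exp (u • -X)))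
      (A * (X * NormedSpace.exp ((0:ℝ) • X)) * A * (-X * NormedSpace.exp ((0:ℝ) • -X)) +
        A * NormedSpace.exp ((0:ℝ) • X) * A * (-X * (-X * NormedSpace.exp ((0:ℝ) • -X)))) 0 :=
    (((hasDerivAt_exp_smul_const' X 0).const_mul A).mul_const A).mul e2
  have h := (hasDerivAt_trace (t1.add t2)).const_mul (((Fintype.card m : ℂ))⁻¹)
  have h' : HasDerivAt (genSignalDeriv U O G)
      (((Fintype.card m : ℂ))⁻¹ *
        (A * (X * (X * NormedSpace.exp ((0:ℝ) • X))) * A * NormedSpace.exp ((0:ℝ) • -X) +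
            A * (X * NormedSpace.exp ((0:ℝ) • X)) * A * (-X * NormedSpace.exp ((0:ℝ) • -X)) +
          (A * (X * NormedSpace.exp ((0:ℝ) • X)) * A * (-X * NormedSpace.exp ((0:ℝ) • -X)) +
            A * NormedSpace.exp ((0:ℝ) • X) * A * (-X * (-X * NormedSpace.exp ((0:ℝ) • -X))))).trace) 0 := by
    have hfun : genSignalDeriv U O G = fun y : ℝ => ((Fintype.card m : ℂ))⁻¹ *
        (((fun u : ℝ => A * (X * NormedSpace.exp (u • X)) * A * NormedSpace.exp (u • -X)) + fun u : ℝ =>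
              A * NormedSpace.exp (u • X) * A * (-X * NormedSpace.exp (u • -X))) y).trace := by
      funext u
      rw [genSignalDeriv, Pi.add_apply, hA, hX]
    rw [hfun]
    exact h
  refine h'.congr_deriv ?_
  simp only [zero_smul, NormedSpace.exp_zero, Matrix.mul_one]
  congr 1
  -- X = iG: X² = −G², and A X A (−X) = A G A G
  have hXX : X * X = -(G * G) := by
    rw [hX, Matrix.smul_mul, Matrix.mul_smul, smul_smul, Complex.I_mul_I, neg_smul, one_smul]
  have hXnX : ∀ B : Matrix m m ℂ, X * B * -X = G * B * G := by
    intro B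
    rw [hX, Matrix.mul_neg, Matrix.smul_mul, Matrix.mul_smul, Matrix.smul_mul, smul_smul,
      ← neg_smul, neg_mul_eq_neg_mul]
    rw [show -Complex.I * Complex.I = 1 by rw [neg_mul, Complex.I_mul_I, neg_neg], one_smul]
  have hnXnX : -X * -X = -(G * G) := by rw [neg_mul_neg, hXX]
  -- put everything in terms of G
  have eA : A * (X * X) * A = -(A * (G * G) * A) := by
    rw [hXX, Matrix.mul_neg, Matrix.neg_mul]
  have eB : A * X * A * -X = A * G * A * G := by
    rw [Matrix.mul_assoc A X A, Matrix.mul_assoc A (X * A) (-X), hXnX, ← Matrix.mul_assoc,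
      ← Matrix.mul_assoc]
  have eC : A * A * (-X * -X) = -(A * A * (G * G)) := by rw [hnXnX, Matrix.mul_neg]
  calc (A * (X * X) * A + A * X * A * -X + (A * X * A * -X + A * A * (-X * -X))).trace
      = (-(A * (G * G) * A) + A * G * A * G + (A * G * A * G + -(A * A * (G * G)))).trace := by
        rw [eA, eB, eC]
    _ = (-(A * (G * G) * A) + A * G * A * G + A * G * A * G - A * A * (G * G)).trace := by
        congr 1; abel

/-- **The printed small-`δ` law `S_δ ≈ 1 − (δ²/2)·C`, as exact second-order Taylor data.**  For
unitary `U`, a Hermitian involutive observable `O` (`O† = O`, `O² = 1`) and a Hermitian generator `G`,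
the OLE signal along `V_δ = e^{−iδG}` satisfies `S(0) = 1`, `S'(δ)` exists for every `δ` with
`S'(0) = 0`, and `S''(0) = −C` where `C = d⁻¹ Tr([A,G]†[A,G])`, `A = U†OU`, is the
infinite-temperature squared commutator (OTOC) between the evolved observable and the GENERATOR of
`V_δ` — i.e. the second-order Taylor polynomial of `S` at `δ = 0` is `1 − (δ²/2)·C`, for any Hermitian
generator (not only a single Pauli string as in `signal_pauliRot_eq_one_sub_half_sqComm`).
[cite: BarronEtAl2026, p. 2 (eq. (1) and “V_δ is the product of single-qubit rotations by an angle δ on a subset of qubits … S_δ ≈ 1 − (δ²/2) C”)]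
[cite: MiEtAl2021, p. 2 (`C(t) = 1 − ½⟨|[Ô(t), M̂]|²⟩`)] -/
theorem genSignal_secondOrder [Nonempty m] {U O G : Matrix m m ℂ} (hU : U * Uᴴ = 1)
    (hO : Oᴴ = O) (hO2 : O * O = 1) (hG : Gᴴ = G) :
    genSignal U O G 0 = 1 ∧
      (∀ δ, HasDerivAt (genSignal U O G) (genSignalDeriv U O G δ) δ) ∧
      genSignalDeriv U O G 0 = 0 ∧
      HasDerivAt (genSignalDeriv U O G)
        (-(((Fintype.card m : ℂ))⁻¹ *
          ((heis U O * G - G * heis U O)ᴴ * (heis U O * G - G * heis U O)).trace)) 0 := by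
  refine ⟨genSignal_zero hU hO2 G, hasDerivAt_genSignal hG, genSignalDeriv_zero U O G, ?_⟩
  have h := hasDerivAt_genSignalDeriv_zero U O G
  refine h.congr_deriv ?_
  set A := heis U O with hA
  have hAh : Aᴴ = A := by rw [hA, conjTranspose_heis, hO]
  have hA2 : A * A = 1 := by
    rw [hA, heis_mul_heis hU, hO2, heis, Matrix.mul_one, ← Matrix.star_eq_conjTranspose,
      (Matrix.mem_unitaryGroup_iff'.mp (Matrix.mem_unitaryGroup_iff.mpr
        (by rwa [Matrix.star_eq_conjTranspose])))]
  -- the commutator side: `Tr((GA − AG)(AG − GA)) = 2Tr(G²) − 2Tr(AGAG)`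
  have hct : (A * G - G * A)ᴴ = G * A - A * G := by
    rw [conjTranspose_sub, conjTranspose_mul, conjTranspose_mul, hAh, hG]
  have c1 : (G * A * (A * G)).trace = (G * G).trace := by
    rw [Matrix.mul_assoc G A (A * G), ← Matrix.mul_assoc A A G, hA2, Matrix.one_mul]
  have c2 : (G * A * (G * A)).trace = (A * G * A * G).trace := by
    rw [Matrix.mul_assoc G A (G * A), Matrix.trace_mul_comm G (A * (G * A))]
    simp only [Matrix.mul_assoc]
  have c3 : (A * G * (G * A)).trace = (G * G).trace := by
    rw [Matrix.trace_mul_comm (A * G) (G * A), c1]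
  have c4 : (A * G * (A * G)).trace = (A * G * A * G).trace := by
    rw [← Matrix.mul_assoc]
  have hT : ((A * G - G * A)ᴴ * (A * G - G * A)).trace =
      2 * (G * G).trace - 2 * (A * G * A * G).trace := by
    rw [hct, Matrix.sub_mul, Matrix.mul_sub, Matrix.mul_sub, trace_sub, trace_sub, trace_sub,
      c1, c2, c3, c4]
    ring
  -- the derivative side: `−Tr(AG²A) + 2Tr(AGAG) − Tr(A²G²) = −2Tr(G²) + 2Tr(AGAG)`
  have l1 : (A * (G * G) * A).trace = (G * G).trace := by
    rw [Matrix.trace_mul_comm (A * (G * G)) A, ← Matrix.mul_assoc, hA2, Matrix.one_mul]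
  have l2 : (A * A * (G * G)).trace = (G * G).trace := by rw [hA2, Matrix.one_mul]
  have hL : (-(A * (G * G) * A) + A * G * A * G + A * G * A * G - A * A * (G * G)).trace =
      -(2 * (G * G).trace - 2 * (A * G * A * G).trace) := by
    rw [trace_sub, trace_add, trace_add, trace_neg, l1, l2]
    ring
  rw [hL, hT, mul_neg]

/-- **Commuting generators compose**: `e^{−iδ(G₁+G₂)} = e^{−iδG₁} e^{−iδG₂}` for commuting `G₁`, `G₂`
(`Matrix.exp_add_of_commute`) — so the printed product of single-qubit rotations on a subset of
qubits (pairwise commuting generators) is `genPert` of their sum. [cite: BarronEtAl2026, p. 2 (eq. (1) and “V_δ is the product of single-qubit rotations by an angle δ on a subset of qubits … S_δ ≈ 1 − (δ²/2) C”)] -/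
theorem genPert_add_of_commute {G₁ G₂ : Matrix m m ℂ} (h : Commute G₁ G₂) (δ : ℝ) :
    genPert (G₁ + G₂) δ = genPert G₁ δ * genPert G₂ δ := by
  rw [genPert_eq, genPert_eq, genPert_eq, smul_add, neg_add, smul_add]
  refine Matrix.exp_add_of_commute _ _ ?_
  exact ((h.smul_left _).smul_right _).neg_left.neg_right |>.smul_left _ |>.smul_right _

end Generator

end OLE

end Literature.Computability.QuantumComplexity
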